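import Mathlib
import Summits.Ventures.PercRepro2.Defs
import Summits.Ventures.PercRepro2.Independence
import Summits.Ventures.PercRepro2.Harris
import Summits.Ventures.PercRepro2.Graph
import Summits.Ventures.PercRepro2.Events
import Summits.Ventures.PercRepro2.ZCTwoEdge
import Summits.Ventures.PercRepro2.ZCLeafReductions
import Summits.Ventures.PercRepro2.ZCLeafReductionsGraph

/-!
# The non-mark leaf identity for (ZC): `Z_G(𝒰) = (1 − w) Z_{G−v}(𝒰) + w Z_{G−v}(𝒰_z)`
(blind cell PercRepro2, mine-a g23; MINE-A.md §70.4 (L0))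

Let `v ∉ {a₁, a₃, o}` be a leaf, joined to the rest only by `f = zv` of weight `w`.  The events
`e = {a₁ ↔ a₃}`, `L = {a₁ ↔ o}`, `γ = {a₃ ↔ o}` do not see `v`, and `C(a₁) = C⁻(a₁) ∪ ({v} if f open
and z ∈ C⁻(a₁))`, so `U = ({f open} ∩ X_z) ∪ ({f closed} ∩ X₀)` with `X₀ = {C⁻(a₁) ∈ 𝒰}`,
`X_z = {C⁻(a₁) ∈ 𝒰_z}`.  Since the (ZC) expression is LINEAR in the indicator of `U`, pinning `f`
gives the exact identity
  `(ZC)_p(a₁, a₃, o; 𝒰) = (1 − p f) · (ZC)_{p[f↦0]}(a₁, a₃, o; 𝒰) + p f · (ZC)_{p[f↦0]}(a₁, a₃, o; 𝒰_z)`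
(`zc_leaf_nonmark`, abstract; `zc_leaf_nonmark_graph` on the graph).  With `zc_leaf_o_graph` and
`zc_leaf_a3_graph` this makes the class of (ZC)-graphs closed under attaching any leaf other than
the root.  One seat; twinned in exact rationals (data/mine-a/g23/codes/twin_pendant.py, L0:
250 / 250 cells equal).
-/

namespace Summit.Ventures.PercRepro2

section NonMarkLeaf

variable {E : Type*} [Fintype E] [DecidableEq E] {R : Type*} [CommRing R]

/-- **(L0), abstract form.**  `e'`, `L'`, `X₀`, `X_z` ignore `f` (`γ'` is arbitrary); the (ZC) expression with
`U = ({f open} ∩ X_z) ∪ ({f closed} ∩ X₀)` is the `p f`-mixture of the (ZC) expressions with `U = X_z`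
and with `U = X₀`. -/
theorem zc_leaf_nonmark (p : E → R) (f : E) {e' L' X₀ Xz : Set (Config E)} (γ' : Set (Config E))
    (he' : ∀ (ω : Config E) (b : Bool), Function.update ω f b ∈ e' ↔ ω ∈ e')
    (hL' : ∀ (ω : Config E) (b : Bool), Function.update ω f b ∈ L' ↔ ω ∈ L')
    (hX₀ : ∀ (ω : Config E) (b : Bool), Function.update ω f b ∈ X₀ ↔ ω ∈ X₀)
    (hXz : ∀ (ω : Config E) (b : Bool), Function.update ω f b ∈ Xz ↔ ω ∈ Xz) :
    let U := (openEdge f ∩ Xz) ∪ (closedEdge f ∩ X₀)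
    prob p (e'ᶜ ∩ L'ᶜ ∩ γ'ᶜ) * (prob p (U ∩ (e' ∩ L')) - prob p U * prob p (e' ∩ L'))
      - prob p (e'ᶜ ∩ L'ᶜ ∩ γ') * (prob p (U ∩ (e' ∩ L'ᶜ)) - prob p U * prob p (e' ∩ L'ᶜ))
      = (1 - p f) * (prob p (e'ᶜ ∩ L'ᶜ ∩ γ'ᶜ) * (prob p (X₀ ∩ (e' ∩ L')) - prob p X₀ * prob p (e' ∩ L'))
          - prob p (e'ᶜ ∩ L'ᶜ ∩ γ') * (prob p (X₀ ∩ (e' ∩ L'ᶜ)) - prob p X₀ * prob p (e' ∩ L'ᶜ)))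
        + p f * (prob p (e'ᶜ ∩ L'ᶜ ∩ γ'ᶜ) * (prob p (Xz ∩ (e' ∩ L')) - prob p Xz * prob p (e' ∩ L'))
          - prob p (e'ᶜ ∩ L'ᶜ ∩ γ') * (prob p (Xz ∩ (e' ∩ L'ᶜ)) - prob p Xz * prob p (e' ∩ L'ᶜ))) := by
  intro U
  have PU : prob p U = p f * prob p Xz + (1 - p f) * prob p X₀ := by
    rw [prob_pin_shift p f]
    have c1 : {ω | Function.update ω f true ∈ U} = Xz := by
      ext ω; simp [U, hXz]
    have c0 : {ω | Function.update ω f false ∈ U} = X₀ := by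
      ext ω; simp [U, hX₀]
    rw [c1, c0]
  have PUeL : prob p (U ∩ (e' ∩ L')) = p f * prob p (Xz ∩ (e' ∩ L'))
      + (1 - p f) * prob p (X₀ ∩ (e' ∩ L')) := by
    rw [prob_pin_shift p f]
    have c1 : {ω | Function.update ω f true ∈ (U ∩ (e' ∩ L'))} = Xz ∩ (e' ∩ L') := by
      ext ω; simp [U, he', hL', hXz]; tauto
    have c0 : {ω | Function.update ω f false ∈ (U ∩ (e' ∩ L'))} = X₀ ∩ (e' ∩ L') := by
      ext ω; simp [U, he', hL', hX₀]; tauto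
    rw [c1, c0]
  have PUenL : prob p (U ∩ (e' ∩ L'ᶜ)) = p f * prob p (Xz ∩ (e' ∩ L'ᶜ))
      + (1 - p f) * prob p (X₀ ∩ (e' ∩ L'ᶜ)) := by
    rw [prob_pin_shift p f]
    have c1 : {ω | Function.update ω f true ∈ (U ∩ (e' ∩ L'ᶜ))} = Xz ∩ (e' ∩ L'ᶜ) := by
      ext ω; simp [U, he', hL', hXz]; tauto
    have c0 : {ω | Function.update ω f false ∈ (U ∩ (e' ∩ L'ᶜ))} = X₀ ∩ (e' ∩ L'ᶜ) := by
      ext ω; simp [U, he', hL', hX₀]; tauto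
    rw [c1, c0]
  rw [PU, PUeL, PUenL]; ring

end NonMarkLeaf

section NonMarkLeafGraph

variable {V : Type*} {E : Type*} [Fintype E] [DecidableEq E] {R : Type*} [CommRing R]

/-- **(L0) on the graph.**  `v ∉ {a₁, a₃, o}` a leaf at `z` through `f`; `𝓔` any family of vertex
sets; `p' = p[f ↦ 0]`, `𝓔_z = {S ∣ (z ∈ S ∧ insert v S ∈ 𝓔) ∨ (z ∉ S ∧ S ∈ 𝓔)}`:
  `(ZC)_p(a₁, a₃, o; 𝓔) = (1 − p f) · (ZC)_{p'}(a₁, a₃, o; 𝓔) + p f · (ZC)_{p'}(a₁, a₃, o; 𝓔_z)`. -/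
theorem zc_leaf_nonmark_graph (p : E → R) {ends : E → Sym2 V} {a₁ a₃ o v z : V} {f : E}
    (hends : ends f = s(z, v)) (hleaf : ∀ e, v ∈ ends e → e = f) (hv1 : v ≠ a₁) (hv3 : v ≠ a₃)
    (hvo : v ≠ o) (hvz : v ≠ z) (𝓔 : Set (Set V)) :
    let e := connEvent ends a₁ a₃
    let L := connEvent ends a₁ o
    let U := clusterInEvent ends a₁ 𝓔
    let γ := connEvent ends a₃ o
    let p' := Function.update p f 0
    let 𝓔z : Set (Set V) := {S | (z ∈ S ∧ insert v S ∈ 𝓔) ∨ (z ∉ S ∧ S ∈ 𝓔)}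
    let U' := clusterInEvent ends a₁ 𝓔z
    prob p (eᶜ ∩ Lᶜ ∩ γᶜ) * (prob p (U ∩ (e ∩ L)) - prob p U * prob p (e ∩ L))
      - prob p (eᶜ ∩ Lᶜ ∩ γ) * (prob p (U ∩ (e ∩ Lᶜ)) - prob p U * prob p (e ∩ Lᶜ))
      = (1 - p f) * (prob p' (eᶜ ∩ Lᶜ ∩ γᶜ) * (prob p' (U ∩ (e ∩ L)) - prob p' U * prob p' (e ∩ L))
          - prob p' (eᶜ ∩ Lᶜ ∩ γ) * (prob p' (U ∩ (e ∩ Lᶜ)) - prob p' U * prob p' (e ∩ Lᶜ)))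
        + p f * (prob p' (eᶜ ∩ Lᶜ ∩ γᶜ) * (prob p' (U' ∩ (e ∩ L)) - prob p' U' * prob p' (e ∩ L))
          - prob p' (eᶜ ∩ Lᶜ ∩ γ) * (prob p' (U' ∩ (e ∩ Lᶜ)) - prob p' U' * prob p' (e ∩ Lᶜ))) := by
  intro e L U γ p' 𝓔z U'
  have hzv : z ≠ v := Ne.symm hvz
  -- the `ω⁻`-events
  set E' : Set (Config E) := {ω | Function.update ω f false ∈ e} with hE'
  set L'' : Set (Config E) := {ω | Function.update ω f false ∈ L} with hL''
  set γ'' : Set (Config E) := {ω | Function.update ω f false ∈ γ} with hγ''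
  set X₀ : Set (Config E) := {ω | Function.update ω f false ∈ U} with hX₀
  set Xz : Set (Config E) := {ω | Function.update ω f false ∈ U'} with hXz
  have he : e = E' := by
    ext ω
    simp only [e, E', Set.mem_setOf_eq, mem_connEvent]
    exact conn_leaf_iff_of_ne hends hleaf hzv ω (Ne.symm hv1) (Ne.symm hv3)
  have hL : L = L'' := by
    ext ω
    simp only [L, L'', Set.mem_setOf_eq, mem_connEvent]
    exact conn_leaf_iff_of_ne hends hleaf hzv ω (Ne.symm hv1) (Ne.symm hvo)
  have hγ : γ = γ'' := by
    ext ω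
    simp only [γ, γ'', Set.mem_setOf_eq, mem_connEvent]
    exact conn_leaf_iff_of_ne hends hleaf hzv ω (Ne.symm hv3) (Ne.symm hvo)
  have hU : U = (openEdge f ∩ Xz) ∪ (closedEdge f ∩ X₀) := by
    ext ω
    simp only [U, Xz, X₀, U', 𝓔z, Set.mem_union, Set.mem_inter_iff, Set.mem_setOf_eq,
      mem_clusterInEvent, mem_openEdge, mem_closedEdge]
    rw [cluster_leaf_eq hends hleaf hzv ω (Ne.symm hv1)]
    rcases Bool.eq_false_or_eq_true (ω f) with hf | hf
    · by_cases hz : z ∈ cluster ends (Function.update ω f false) a₁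
      · have hset : cluster ends (Function.update ω f false) a₁
            ∪ {u | u = v ∧ ω f = true ∧ z ∈ cluster ends (Function.update ω f false) a₁}
            = insert v (cluster ends (Function.update ω f false) a₁) := by
          ext u; simp [hf, hz]
        rw [hset]; simp [hf, hz]
      · have hset : cluster ends (Function.update ω f false) a₁
            ∪ {u | u = v ∧ ω f = true ∧ z ∈ cluster ends (Function.update ω f false) a₁}
            = cluster ends (Function.update ω f false) a₁ := by
          ext u; simp [hz]
        rw [hset]; simp [hf, hz]
    · have hset : cluster ends (Function.update ω f false) a₁
          ∪ {u | u = v ∧ ω f = true ∧ z ∈ cluster ends (Function.update ω f false) a₁}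
          = cluster ends (Function.update ω f false) a₁ := by
        ext u; simp [hf]
      rw [hset]; simp [hf]
  have inv : ∀ (A : Set (Config E)) (ω : Config E) (b : Bool),
      Function.update ω f b ∈ {ω | Function.update ω f false ∈ A} ↔
        ω ∈ {ω | Function.update ω f false ∈ A} := by
    intro A ω b; simp only [Set.mem_setOf_eq, closeOne_update]
  have key := zc_leaf_nonmark p f γ'' (inv e) (inv L) (inv U) (inv U')
  simp only at key
  conv_lhs => rw [he, hL, hU, hγ]
  simp only [hE', hL'', hγ'', hX₀, hXz] at key ⊢
  simp only [p', prob_update_zero_eq_shift, closeOne_setOf_inter, closeOne_setOf_compl]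
  exact key

end NonMarkLeafGraph

end Summit.Ventures.PercRepro2
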